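import Mathlib.Algebra.Group.Submonoid.Operations
import Mathlib.Data.Int.Basic
import Mathlib.Logic.Function.Basic
import HarnessLib

/-!
# [IUTchIII] Proposition 3.7, Definition 3.8: global realified LGP- and lgp-Frobenioids, the
# Θ^{×μ}_{LGP}-link, Θ- and q-pilot objects, the LGP-Gaussian log-theta-lattice
# (abc-iut cell, layer L6, slice [IUTchIII] §3)

S. Mochizuki, *Inter-universal Teichmüller theory III*, kurims manuscript (May 2020) of PRIMS
**57** (2021), §3: Proposition 3.7 pp. 109–112, Definition 3.8 pp. 112–114, Remarks 3.8.1–3.8.3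
pp. 114–115 (PRIMS offset ≈ +420). Proposition 3.7 is a CONSTRUCTION ("functorial algorithm … for
constructing") inside a Θ^{±ell}NF-Hodge theater; its inputs (Hodge theaters [IUTchI] Def. 6.13,
`𝓕^⊩`- and `𝓕^{⊩▶×μ}`-prime-strips [IUTchII] Def. 4.9, the strips `†𝔉^⊩_gau`, `*𝔉^⊩_△` of [IUTchII]
Cor. 4.10, log-links [IUTchIII] Def. 1.1, Frobenioids [FrdI]) are owned by other seats
(abc-iut-L5-t4, L6-t2, L6-t3, L1). STATEMENTS-FIRST typing records an OUTPUT SIGNATURE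
(`GlobalLGPFrobenioidSignature`: data fields = named outputs, `Prop` fields = printed properties;
Frobenioids, prime-strips and their isomorphisms enter as abstract types `Frd`, `Strip`, `IsoF`,
`IsoS`, `Ob`). What IS definable outright is defined: the Θ^{×μ}_{LGP}- and Θ^{×μ}_{lgp}-links as
FULL poly-isomorphisms (Definition 3.8 (ii)) = `Set.univ` of the isomorphism type; the LGP-Gaussian
log-theta-lattice (Definition 3.8 (iii)) as a `ℤ × ℤ`-indexed family with full vertical log-links
and its oriented graph; the Θ-pilot and q-pilot objects (Definition 3.8 (i)) as values of the
object-forming algorithm of Proposition 3.7 (v) on generators up to torsion. Decl names for the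
Cor. 3.12 crew (abc-iut-c312-1/2): `thetaPilotObject`, `qPilotObject`, `thetaLGPLink`,
`thetaLgpLink`, `LGPGaussianLogThetaLattice`. Tag form [claim: Mochizuki2012, status: disputed].
-/

namespace Literature.IUT.LogThetaLattice

universe u v w

/-! ### Proposition 3.7: global packet-theoretic Frobenioids (output signature) -/

section Prop37

variable (lstar : ℕ) (V : Type v) (isBad : V → Prop)

/-- OUTPUT SIGNATURE of [IUTchIII] Proposition 3.7 "(Global Packet-theoretic Frobenioids)",
pp. 109–112, for one log-link `‡𝓗𝓣 →^{log} †𝓗𝓣` and the labels `j ∈ 𝔽_l^⋇` (= `Fin lstar`):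
(i) Frobenioids `(†𝓕⊛_MOD)_j` (rational function torsor version, Example 3.6 (i), built from the
number field `(†𝕄⊛_MOD)_j` = image of the localization homomorphism) with natural isomorphisms
`(†𝓕⊛_mod)_j ≅ (†𝓕⊛_MOD)_j`; (ii) Frobenioids `(†𝓕⊛_𝔪𝔬𝔡)_j` (local fractional ideal version, Example
3.6 (ii), built from the Galois invariants of the local monoids `Ψ_{log(^{A,α}𝓕_v)}`) with natural
isomorphisms `(†𝓕⊛_mod)_j ≅ (†𝓕⊛_𝔪𝔬𝔡)_j ≅ (†𝓕⊛_MOD)_j`; (iii) the global realified LGP-Frobenioid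
`†𝒞^⊩_LGP` and the `𝓕^⊩`-prime-strip `†𝔉^⊩_LGP` with `†𝔉^⊩_gau ≅ †𝔉^⊩_LGP`; (iv) the lgp-versions
`†𝒞^⊩_lgp`, `†𝔉^⊩_lgp` with `†𝔉^⊩_gau ≅ †𝔉^⊩_LGP ≅ †𝔉^⊩_lgp`; (v) the realified product embeddings
`†𝒞^⊩_LGP ↪ Π_j (†𝓕⊛ℝ_MOD)_j`, `†𝒞^⊩_lgp ↪ Π_j (†𝓕⊛ℝ_𝔪𝔬𝔡)_j` (commutative square with isomorphic
verticals) and "an algorithm for constructing … objects of the [global!] categories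
`𝒞^⊩_lgp(†𝓗𝓣)`, `𝒞^⊩_LGP(†𝓗𝓣)` from the local fractional ideals generated by elements of the monoids
`Ψ_{𝓕_lgp}(†𝓗𝓣)_v` for `v ∈ 𝕍^bad`". Abstract parameters: `Frd` = a type of Frobenioids with
isomorphism types `IsoF`, object-type function `Ob`; `Strip` = `𝓕^⊩`-prime-strips with `IsoS`;
`M v` = the monoids `Ψ_{𝓕_lgp}(†𝓗𝓣)_v` at bad `v`. TODO-merge: [FrdI] (abc-iut-L1), [IUTchII] Def. 4.9
/ Cor. 4.10 (abc-iut-L6-t2). [claim: Mochizuki2012, status: disputed] -/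
structure GlobalLGPFrobenioidSignature (Frd : Type u) (IsoF : Frd → Frd → Type w)
    (Ob : Frd → Type w) (realify : Frd → Frd) (Strip : Type u) (IsoS : Strip → Strip → Type w)
    (M : ∀ v : V, isBad v → Type w) where
  /-- (i) `(†𝓕⊛_MOD)_j` -/
  FMOD : Fin lstar → Frd
  /-- (i)/(ii) `(†𝓕⊛_mod)_j` ([IUTchII] Cor. 4.8 (ii)) -/
  Fmod : Fin lstar → Frd
  /-- (ii) `(†𝓕⊛_𝔪𝔬𝔡)_j` -/
  Ffrak : Fin lstar → Frd
  /-- (i) the natural isomorphism `(†𝓕⊛_mod)_j ≅ (†𝓕⊛_MOD)_j` -/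
  isoModMOD : ∀ j, IsoF (Fmod j) (FMOD j)
  /-- (ii) the natural isomorphism `(†𝓕⊛_mod)_j ≅ (†𝓕⊛_𝔪𝔬𝔡)_j` -/
  isoModFrak : ∀ j, IsoF (Fmod j) (Ffrak j)
  /-- (ii) the natural isomorphism `(†𝓕⊛_𝔪𝔬𝔡)_j ≅ (†𝓕⊛_MOD)_j` -/
  isoFrakMOD : ∀ j, IsoF (Ffrak j) (FMOD j)
  /-- (iii) the global realified LGP-Frobenioid `†𝒞^⊩_LGP = 𝒞^⊩_LGP(†𝓗𝓣)` -/
  CLGP : Frd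
  /-- (iv) the global realified lgp-Frobenioid `†𝒞^⊩_lgp = 𝒞^⊩_lgp(†𝓗𝓣)` -/
  Clgp : Frd
  /-- (iii) `†𝔉^⊩_LGP`; (iv) `†𝔉^⊩_lgp`; the Gaussian strip `†𝔉^⊩_gau` of [IUTchII] Cor. 4.10 (ii) -/
  FLGP : Strip
  /-- (iv) `†𝔉^⊩_lgp` -/
  Flgp : Strip
  /-- `†𝔉^⊩_gau` ([IUTchII] Cor. 4.10 (ii)) -/
  Fgau : Strip
  /-- (iii) the natural (tautological) isomorphism `†𝔉^⊩_gau ≅ †𝔉^⊩_LGP` -/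
  isoGauLGP : IsoS Fgau FLGP
  /-- (iv) the tautological isomorphism `†𝔉^⊩_LGP ≅ †𝔉^⊩_lgp` -/
  isoLGPlgp : IsoS FLGP Flgp
  /-- (v) the vertical isomorphism `†𝒞^⊩_LGP ≅ †𝒞^⊩_lgp` of the commutative square -/
  isoCLGPlgp : IsoF CLGP Clgp
  /-- (v) left embedding: objects of `†𝒞^⊩_LGP` ↦ objects of `Π_j (†𝓕⊛ℝ_MOD)_j` -/
  embLGP : Ob CLGP → ∀ j, Ob (realify (FMOD j))
  /-- (v) lower embedding: objects of `†𝒞^⊩_lgp` ↦ objects of `Π_j (†𝓕⊛ℝ_𝔪𝔬𝔡)_j` -/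
  embLgp : Ob Clgp → ∀ j, Ob (realify (Ffrak j))
  /-- (v) "the horizontal arrows are embeddings": injective on objects -/
  embLGP_injective : Function.Injective embLGP
  /-- (v) idem for the lgp-embedding -/
  embLgp_injective : Function.Injective embLgp
  /-- (v) the object-forming algorithm: objects of `†𝒞^⊩_lgp` "from the local fractional ideals
  generated by elements of the monoids `Ψ_{𝓕_lgp}(†𝓗𝓣)_v` for `v ∈ 𝕍^bad`" -/
  objOfLgp : (∀ v (h : isBad v), M v h) → Ob Clgp
  /-- (v) idem for `†𝒞^⊩_LGP` (compatible with `isoCLGPlgp`) -/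
  objOfLGP : (∀ v (h : isBad v), M v h) → Ob CLGP
  /-- (v) the non-realified version: the object of `Π_j (†𝓕⊛_𝔪𝔬𝔡)_j` so determined -/
  objOfFrak : (∀ v (h : isBad v), M v h) → ∀ j, Ob (Ffrak j)
  /-- (v) … and of `Π_j (†𝓕⊛_MOD)_j` -/
  objOfMOD : (∀ v (h : isBad v), M v h) → ∀ j, Ob (FMOD j)

end Prop37

/-! ### Definition 3.8 (i): Θ-pilot and q-pilot objects -/

section Pilots

variable {lstar : ℕ} {V : Type v} {isBad : V → Prop}
variable {Frd : Type u} {IsoF : Frd → Frd → Type w} {Ob : Frd → Type w} {realify : Frd → Frd}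
  {Strip : Type u} {IsoS : Strip → Strip → Type w} {M : ∀ v : V, isBad v → Type w}
  [∀ v h, Monoid (M v h)]

/-- "generator up to torsion" of a commutative monoid `M` (Definition 3.8 (i), p. 112: "generators
up to torsion of the monoids `Ψ^⊥_{𝓕_lgp}(†𝓗𝓣)_v`"; cf. [IUTchII] Cor. 3.6: at bad `v` the
splitting monoid is `μ_{2l} × q^{ℕ}`-like): every element of `M` is a torsion element times a power
of `g`. [claim: Mochizuki2012, status: disputed] -/
def IsGeneratorUpToTorsion {N : Type w} [Monoid N] (g : N) : Prop :=
  ∀ x : N, ∃ (t : N) (k n : ℕ), 0 < k ∧ t ^ k = 1 ∧ x = t * g ^ n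

/-- The splitting monoids `Ψ^⊥_{𝓕_lgp}(†𝓗𝓣)_v := Ψ^⊥_{𝓕_LGP}(†𝓗𝓣)_v`, `v ∈ 𝕍^bad`, of Definition 3.8 (i)
(p. 112) as sub-monoids `Msplit v h ⊆ M v h` of the lgp-monoids, and the datum that each admits a
generator up to torsion. [claim: Mochizuki2012, status: disputed] -/
structure SplittingMonoids (M : ∀ v : V, isBad v → Type w) [∀ v h, Monoid (M v h)] where
  /-- `Ψ^⊥_{𝓕_lgp}(†𝓗𝓣)_v` -/
  Msplit : ∀ v h, Submonoid (M v h)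
  /-- each splitting monoid has a generator up to torsion -/
  exists_gen : ∀ v h, ∃ g : Msplit v h, IsGeneratorUpToTorsion g

/-- **Θ-pilot object** ([IUTchIII] Definition 3.8 (i), p. 112): "the object of
`Π_{j∈𝔽_l^⋇} (†𝓕⊛_MOD)_j` or `Π_{j∈𝔽_l^⋇} (†𝓕⊛_𝔪𝔬𝔡)_j` — as well as its realification, regarded as an object
of `†𝒞^⊩_LGP` or `†𝒞^⊩_lgp` — determined by any collection, indexed by `v ∈ 𝕍^bad`, of generators up to
torsion of the monoids `Ψ^⊥_{𝓕_lgp}(†𝓗𝓣)_v`", here in its `†𝒞^⊩_lgp`-incarnation: the value of the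
object-forming algorithm of Proposition 3.7 (v) on a chosen collection of generators (that the
object does not depend on the choice is `thetaPilotObject_wellDefined`).
[claim: Mochizuki2012, status: disputed] -/
noncomputable def thetaPilotObject
    (S : GlobalLGPFrobenioidSignature lstar V isBad Frd IsoF Ob realify Strip IsoS M)
    (Sp : SplittingMonoids M) : Ob S.Clgp :=
  S.objOfLgp fun v h => ((Classical.choose (Sp.exists_gen v h) : Sp.Msplit v h) : M v h)

/-- The `Π_j (†𝓕⊛_𝔪𝔬𝔡)_j`-incarnation of the Θ-pilot object (Definition 3.8 (i), p. 112).
[claim: Mochizuki2012, status: disputed] -/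
noncomputable def thetaPilotObjectFrak
    (S : GlobalLGPFrobenioidSignature lstar V isBad Frd IsoF Ob realify Strip IsoS M)
    (Sp : SplittingMonoids M) : ∀ j, Ob (S.Ffrak j) :=
  S.objOfFrak fun v h => ((Classical.choose (Sp.exists_gen v h) : Sp.Msplit v h) : M v h)

/-- Definition 3.8 (i), p. 112, says the Θ-pilot object is "determined by ANY collection … of
generators up to torsion": the implicit well-definedness claim, typed — the object-forming
algorithm takes the same value on any two collections of generators up to torsion of the splitting
monoids. [claim: Mochizuki2012, status: disputed] -/
def thetaPilotObject_wellDefined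
    (S : GlobalLGPFrobenioidSignature lstar V isBad Frd IsoF Ob realify Strip IsoS M)
    (Sp : SplittingMonoids M) : Prop :=
  ∀ g g' : ∀ v h, Sp.Msplit v h,
    (∀ v h, IsGeneratorUpToTorsion (g v h)) → (∀ v h, IsGeneratorUpToTorsion (g' v h)) →
      S.objOfLgp (fun v h => (g v h : M v h)) = S.objOfLgp fun v h => (g' v h : M v h)

/-- **q-pilot object** ([IUTchIII] Definition 3.8 (i), p. 112): "the object of the [global realified]
Frobenioid `†𝒞^⊩_△` of [IUTchII], Corollary 4.10, (i), determined by any collection, indexed by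
`v ∈ 𝕍^bad`, of generators up to torsion of the splitting monoid associated to the split Frobenioid
`†𝓕^⊢_{△,v}` … — that is to say, at a more concrete level, determined by the `q_v`, for `v ∈ 𝕍^bad`
[cf. the notation of [IUTchI], Example 3.2, (iv)]". Data: the object type `ObΔ` of `†𝒞^⊩_△`, the
splitting monoids `N v` with the distinguished generators `q_v`, and the object-forming map.
[claim: Mochizuki2012, status: disputed] -/
structure QPilotData (ObΔ : Type w) (N : ∀ v : V, isBad v → Type w) [∀ v h, Monoid (N v h)] where
  /-- the `q`-parameters `q_v ∈` splitting monoid of `†𝓕^⊢_{△,v}`, `v ∈ 𝕍^bad` -/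
  q : ∀ v h, N v h
  /-- `q_v` generates up to torsion -/
  q_gen : ∀ v h, IsGeneratorUpToTorsion (q v h)
  /-- the object of `†𝒞^⊩_△` determined by a collection of generators -/
  objOf : (∀ v h, N v h) → ObΔ

/-- The q-pilot object: the object of `†𝒞^⊩_△` determined by the `q_v`, `v ∈ 𝕍^bad` (Definition 3.8
(i), p. 112). [claim: Mochizuki2012, status: disputed] -/
def qPilotObject {ObΔ : Type w} {N : ∀ v : V, isBad v → Type w} [∀ v h, Monoid (N v h)]
    (D : QPilotData ObΔ N) : ObΔ :=
  D.objOf D.q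

end Pilots

/-! ### Definition 3.8 (ii), (iii): the Θ^{×μ}_{LGP}-link and the LGP-Gaussian log-theta-lattice -/

section Links

variable {HT : Type u} (LogLink : HT → HT → Type v) (Strip : Type u) (Iso : Strip → Strip → Type w)

/-- The `𝓕^{⊩▶×μ}`-prime-strips entering Definition 3.8 (ii), p. 113: `†𝔉^{⊩▶×μ}_LGP`, `†𝔉^{⊩▶×μ}_lgp`
(associated, via [IUTchII] Def. 4.9 (vi), (viii), to the strips `†𝔉^⊩_LGP`, `†𝔉^⊩_lgp` of
Proposition 3.7 (iii), (iv) — which depend on the log-link `‡𝓗𝓣 →^{log} †𝓗𝓣`) and `*𝔉^{⊩▶×μ}_△`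
(from `*𝔉^⊩_△` of [IUTchII] Cor. 4.10 (i)). INTERFACE (TODO-merge: abc-iut-L6-t2).
[claim: Mochizuki2012, status: disputed] -/
structure ThetaLinkStrips where
  /-- `†𝔉^{⊩▶×μ}_LGP`, for `†𝓗𝓣` the codomain of a log-link `‡𝓗𝓣 →^{log} †𝓗𝓣` -/
  stripLGP : ∀ {s t : HT}, LogLink s t → Strip
  /-- `†𝔉^{⊩▶×μ}_lgp` -/
  stripLgp : ∀ {s t : HT}, LogLink s t → Strip
  /-- `*𝔉^{⊩▶×μ}_△` of a Θ^{±ell}NF-Hodge theater `*𝓗𝓣` -/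
  stripDelta : HT → Strip

variable {LogLink Strip Iso}

/-- A **full poly-isomorphism** between two prime-strips: the set of ALL isomorphisms ([IUTchI] §0;
used in Definition 3.8 (ii), p. 113). [claim: Mochizuki2012, status: disputed] -/
def fullPolyIso (X Y : Strip) : Set (Iso X Y) := Set.univ

/-- The **Θ^{×μ}_{LGP}-link** `†𝓗𝓣 →^{Θ^{×μ}_{LGP}} *𝓗𝓣` relative to the log-link `‡𝓗𝓣 →^{log} †𝓗𝓣`
([IUTchIII] Definition 3.8 (ii), p. 113): "the full poly-isomorphism of `𝓕^{⊩▶×μ}`-prime-strips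
`†𝔉^{⊩▶×μ}_LGP ≅ *𝔉^{⊩▶×μ}_△`". [claim: Mochizuki2012, status: disputed] -/
def thetaLGPLink (D : ThetaLinkStrips LogLink Strip) {s t : HT} (lg : LogLink s t) (star : HT) :
    Set (Iso (D.stripLGP lg) (D.stripDelta star)) :=
  fullPolyIso _ _

/-- The **Θ^{×μ}_{lgp}-link** `†𝓗𝓣 →^{Θ^{×μ}_{lgp}} *𝓗𝓣` relative to the log-link `‡𝓗𝓣 →^{log} †𝓗𝓣`
([IUTchIII] Definition 3.8 (ii), p. 113): "the full poly-isomorphism of `𝓕^{⊩▶×μ}`-prime-strips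
`†𝔉^{⊩▶×μ}_lgp ≅ *𝔉^{⊩▶×μ}_△`". [claim: Mochizuki2012, status: disputed] -/
def thetaLgpLink (D : ThetaLinkStrips LogLink Strip) {s t : HT} (lg : LogLink s t) (star : HT) :
    Set (Iso (D.stripLgp lg) (D.stripDelta star)) :=
  fullPolyIso _ _

/-- The Θ^{×μ}_{LGP}-link is the FULL poly-isomorphism: every isomorphism of the strips belongs to
it (Definition 3.8 (ii), p. 113). [claim: Mochizuki2012, status: disputed] -/
theorem mem_thetaLGPLink (D : ThetaLinkStrips LogLink Strip) {s t : HT} (lg : LogLink s t)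
    (star : HT) (φ : Iso (D.stripLGP lg) (D.stripDelta star)) : φ ∈ thetaLGPLink D lg star :=
  Set.mem_univ φ

variable (LogLink) in
/-- The **LGP-Gaussian** (resp. **lgp-Gaussian**) **log-theta-lattice** ([IUTchIII] Definition 3.8
(iii), pp. 113–114): "a collection of distinct Θ^{±ell}NF-Hodge theaters `{^{n,m}𝓗𝓣}_{n,m∈ℤ}` …
indexed by pairs of integers", "the vertical arrows are the full log-links, and the horizontal arrow
… from `^{n,m}𝓗𝓣` to `^{n+1,m}𝓗𝓣` is the Θ^{×μ}_{LGP}- (respectively, Θ^{×μ}_{lgp}-) link from `^{n,m}𝓗𝓣` to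
`^{n+1,m}𝓗𝓣`, relative to the full log-link `^{n,m-1}𝓗𝓣 →^{log} ^{n,m}𝓗𝓣`". Since the horizontal arrows
are full poly-isomorphisms (no data), the lattice is the `ℤ × ℤ`-family of theaters with its
vertical full log-links; `IsFull` is the interface predicate "full log-link" ([IUTchIII] Def. 1.1
(iii); TODO-merge: abc-iut-L6-t3, whose Def. 1.4 Gaussian log-theta-lattice this parallels —
Remark 3.8.2). [claim: Mochizuki2012, status: disputed] -/
structure LGPGaussianLogThetaLattice (IsFull : ∀ {s t : HT}, LogLink s t → Prop) where
  /-- `^{n,m}𝓗𝓣^{Θ±ell NF}` -/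
  theater : ℤ → ℤ → HT
  /-- "a collection of distinct Θ^{±ell}NF-Hodge theaters" -/
  distinct : Function.Injective fun p : ℤ × ℤ => theater p.1 p.2
  /-- the vertical arrow `^{n,m}𝓗𝓣 →^{log} ^{n,m+1}𝓗𝓣` -/
  logLink : ∀ n m, LogLink (theater n m) (theater n (m + 1))
  /-- "the vertical arrows are the full log-links" -/
  logLink_full : ∀ n m, IsFull (logLink n m)

/-- The horizontal arrow `^{n,m}𝓗𝓣 →^{Θ^{×μ}_{LGP}} ^{n+1,m}𝓗𝓣` of the LGP-Gaussian log-theta-lattice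
(Definition 3.8 (iii), p. 114): the Θ^{×μ}_{LGP}-link relative to the full log-link
`^{n,m-1}𝓗𝓣 →^{log} ^{n,m}𝓗𝓣`. [claim: Mochizuki2012, status: disputed] -/
def LGPGaussianLogThetaLattice.horizontal {IsFull : ∀ {s t : HT}, LogLink s t → Prop}
    (L : LGPGaussianLogThetaLattice LogLink IsFull) (D : ThetaLinkStrips LogLink Strip)
    (n m : ℤ) :
    Set (Iso (D.stripLGP (L.logLink n (m - 1))) (D.stripDelta (L.theater (n + 1) m))) :=
  thetaLGPLink D (L.logLink n (m - 1)) (L.theater (n + 1) m)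

/-- The oriented graph of Definition 3.8 (iii), p. 114 ("either of these diagrams may be
represented symbolically by an oriented graph … where the •'s correspond to the `^{n,m}𝓗𝓣`"):
vertices `ℤ × ℤ`, an edge `(n,m) → (n+1,m)` (Θ^{×μ}-link) and an edge `(n,m) → (n,m+1)` (log-link).
[claim: Mochizuki2012, status: disputed] -/
def latticeEdge (p q : ℤ × ℤ) : Prop :=
  q = (p.1 + 1, p.2) ∨ q = (p.1, p.2 + 1)

/-- [IUTchIII] Remark 3.8.1, p. 114: "both the Θ^{×μ}_{LGP}- and the Θ^{×μ}_{lgp}-link map Θ-pilot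
objects to q-pilot objects" — typed as the interface statement that every member of the link, via
the induced map on pilot objects `pilotMap`, sends the Θ-pilot object of the domain to the q-pilot
object of the codomain ([IUTchII] Def. 4.9 (viii) "pilot object" of an `𝓕^{⊩▶×μ}`-prime-strip).
[claim: Mochizuki2012, status: disputed] -/
def Remark381_mapsPilots {X Y : Strip} (link : Set (Iso X Y)) {PX PY : Type w}
    (pilotMap : Iso X Y → PX → PY) (thetaPilot : PX) (qPilot : PY) : Prop :=
  ∀ φ ∈ link, pilotMap φ thetaPilot = qPilot

/-- [IUTchIII] Remark 3.8.2, pp. 114–115: "the main results obtained so far concerning Gaussian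
log-theta-lattices — namely, Theorem 1.5, Proposition 2.1, Corollary 2.3 …, and Proposition 3.5 —
generalize immediately [indeed, 'formally'] to the case of LGP- or lgp-Gaussian log-theta-lattices".
Typed as the transfer statement: a property of `ℤ × ℤ`-families of theaters with full vertical
log-links that holds for Gaussian lattices holds for LGP-Gaussian ones (both have the same
underlying vertical data; the named results are abc-iut-L6-t3's Thm 1.5 / Prop 2.1 / Cor 2.3).
[claim: Mochizuki2012, status: disputed] -/
def Remark382_generalize {IsFull : ∀ {s t : HT}, LogLink s t → Prop}
    (P : (ℤ → ℤ → HT) → Prop) (L : LGPGaussianLogThetaLattice LogLink IsFull) : Prop :=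
  P L.theater

/-- [IUTchIII] Remark 3.8.3, p. 115: replacing the unit portions of the `𝓕^{⊩▶×μ}`-prime-strips by
their log-shells (trivial Galois action at nonarchimedean `v`) would NOT suffice: "the nontrivial
Galois action on the local unit portions … is necessary in order to consider the Kummer theory".
Typed as the design statement that the link is the full preimage of ANY set of log-shell
isomorphisms under the forgetful map `toShell` (PROVED: the link is full).
[claim: Mochizuki2012, status: disputed] -/
theorem Remark383_fullLink_preimage {X Y : Strip} {ShellIso : Type w}
    (toShell : Iso X Y → ShellIso) (T : Set ShellIso) :
    toShell ⁻¹' T ⊆ fullPolyIso (Iso := Iso) X Y :=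
  fun _ _ => Set.mem_univ _

/-- [IUTchIII] Remark 3.8.3, p. 115 — CONTENTFUL retype (abc-iut-ref-b PASS-9 B11; the declarations
`Remark382_generalize` and `Remark383_fullLink_preimage` above are SLOT-ONLY / DESIGN-NOTE records and
are excluded from typed counts): "the nontrivial Galois action on the local unit portions of the
`𝓕^{⊩▶×μ}`-prime-strips involved is necessary in order to consider the Kummer theory … of the various
local and global objects for which the log-shells serve as 'multiradial containers'", i.e. one cannot
"replace the unit [i.e., `𝓕^{⊢×μ}`-prime-strip] portions of these prime-strips by the associated
log-shells, on which, at nonarchimedean `v`, the associated local Galois groups act trivially". Typed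
and PROVED as the underlying equivariance obstruction: a Kummer-type map that is equivariant and
injective from a `G_v`-set with a NON-trivial action (the unit portion) cannot take values in a
`G_v`-set with trivial action (a log-shell in the base field) — so the Galois action on the unit
portions cannot be discarded without losing the (injective, equivariant) Kummer theory.
[claim: Mochizuki2012, status: disputed] -/
theorem Remark383_kummerNeedsGaloisAction {G U S : Type*} [Group G] [MulAction G U] [MulAction G S]
    (htriv : ∀ (g : G) (s : S), g • s = s) {u : U} {g : G} (hu : g • u ≠ u) (κ : U → S)
    (hequiv : ∀ (g : G) (x : U), κ (g • x) = g • κ x) : ¬ Function.Injective κ := by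
  intro hinj
  apply hu
  apply hinj
  rw [hequiv, htriv]

end Links

end Literature.IUT.LogThetaLattice
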